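import Summits.AtomisticToContinuum.HydrodynamicLimit.Theorems.JParityClosureRateFloorLineDefs
import Literature.MathematicalPhysics.KineticTheory.HardSphereCanonicalTorus
import HarnessLib

/-!
# Line `Sketch` of crux `RateFloor`, rung 0: scaling lemmas of the static floor assembly
# (helper file, `--supports stmt-AtomisticToContinuum-13080`)

Elementary asymptotics of the window parameters of the rung-0 floor `stub_staticOpacityFloorRung0 ⇐ Plateau′` (c2 lane):
`n = N + 1`, `ε_N = σ n^{-1/3}`, window `Δ_N = windowLenB A b N = A n^{-b}` with `b ∈ [1/3, 1]`, flight-time window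
`κ_N = Δ_N / ε_N = (A/σ) n^{1/3 − b}`.

* `windowLenB_le`, `kappa_le` — `Δ_N ≤ A n^{-1/3}`, `κ_N ≤ A/σ` (`b ≥ 1/3`);
* `sq_eps_mul_windowLenB_ge` — `ε_N² Δ_N ≥ A σ² n^{-5/3}` (`b ≤ 1`), whence `N² ε_N³ κ_N ≥ (Aσ²/4) n^{1/3}` for `N ≥ 1`;
* `shellVol_le` — `(4π/3)((ε(1+2Lκ))³ − ε³) ≤ 8π L κ ε³ (1 + 2Lκ)²`;
* `varianceRatio_le` — the per-window Chebyshev ratio `V_N / t_N²` of `JParityClosureRateFloorTubeChebyshevSharp` with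
  `t_N = ρ n N ε_N³ κ_N` is at most `X n^{-1/3} + Y n⁻¹ + 4 ζ Z` with explicit `X, Y, Z`;
* `eventually_rpow_le`, `eventually_inv_le` — `n^{-1/3} ≤ c` and `n⁻¹ ≤ c` eventually.
-/

noncomputable section

open MeasureTheory Set Filter Topology Function
open scoped BigOperators

namespace Summit.AtomisticToContinuum.HydrodynamicLimit.Theorems

namespace RateFloorStaticFloor

open Literature.Analysis.FluidPDE Literature.MathematicalPhysics.KineticTheory RateFloorLine

/-! ## Powers of `n = N + 1` -/

/-- `1 ≤ n`. [folklore] -/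
theorem one_le_succ_cast (N : ℕ) : (1 : ℝ) ≤ ((N + 1 : ℕ) : ℝ) := by exact_mod_cast Nat.succ_le_succ (Nat.zero_le N)

/-- `n^{-b} ≤ n^{-1/3}` for `b ≥ 1/3`. [folklore] -/
theorem rpow_neg_le_rpow_neg_third {b : ℝ} (hb : 1 / 3 ≤ b) (N : ℕ) :
    ((N + 1 : ℕ) : ℝ) ^ (-b) ≤ ((N + 1 : ℕ) : ℝ) ^ (-(1 / 3 : ℝ)) :=
  Real.rpow_le_rpow_of_exponent_le (one_le_succ_cast N) (by linarith)

/-- `n^{-1} ≤ n^{-b}` for `b ≤ 1`. [folklore] -/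
theorem rpow_neg_one_le_rpow_neg {b : ℝ} (hb : b ≤ 1) (N : ℕ) :
    ((N + 1 : ℕ) : ℝ) ^ (-(1 : ℝ)) ≤ ((N + 1 : ℕ) : ℝ) ^ (-b) :=
  Real.rpow_le_rpow_of_exponent_le (one_le_succ_cast N) (by linarith)

/-! ## The window and the flight-time window -/

/-- `Δ_N ≤ A n^{-1/3}` for `b ≥ 1/3`, `A ≥ 0`. [folklore] -/
theorem windowLenB_le {A b : ℝ} (hA : 0 ≤ A) (hb : 1 / 3 ≤ b) (N : ℕ) :
    windowLenB A b N ≤ A * ((N + 1 : ℕ) : ℝ) ^ (-(1 / 3 : ℝ)) :=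
  mul_le_mul_of_nonneg_left (rpow_neg_le_rpow_neg_third hb N) hA

/-- `Δ_N ≤ A` for `b ≥ 1/3`, `A ≥ 0`. [folklore] -/
theorem windowLenB_le_A {A b : ℝ} (hA : 0 ≤ A) (hb : 1 / 3 ≤ b) (N : ℕ) : windowLenB A b N ≤ A := by
  have h := windowLenB_le hA hb N
  have h1 : ((N + 1 : ℕ) : ℝ) ^ (-(1 / 3 : ℝ)) ≤ 1 :=
    Real.rpow_le_one_of_one_le_of_nonpos (one_le_succ_cast N) (by norm_num)
  exact h.trans ((mul_le_mul_of_nonneg_left h1 hA).trans_eq (mul_one A))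

/-- **The flight-time window is bounded**: `κ_N = Δ_N / ε_N ≤ A / σ` for `b ≥ 1/3` (`A ≥ 0`, `σ > 0`). [folklore] -/
theorem kappa_le {A b σ : ℝ} (hA : 0 ≤ A) (hb : 1 / 3 ≤ b) (hσ : 0 < σ) (N : ℕ) :
    windowLenB A b N / hsDiameter σ N ≤ A / σ := by
  have hε := hsDiameter_pos hσ N
  rw [div_le_div_iff₀ hε hσ]
  unfold windowLenB hsDiameter
  have hn : (0 : ℝ) < ((N + 1 : ℕ) : ℝ) := by positivity
  calc A * ((N + 1 : ℕ) : ℝ) ^ (-b) * σ ≤ A * ((N + 1 : ℕ) : ℝ) ^ (-(1 / 3 : ℝ)) * σ :=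
        mul_le_mul_of_nonneg_right (mul_le_mul_of_nonneg_left (rpow_neg_le_rpow_neg_third hb N) hA) hσ.le
    _ = A * (σ * ((N + 1 : ℕ) : ℝ) ^ (-(1 / 3 : ℝ))) := by ring

/-- `ε_N² Δ_N ≥ A σ² n^{-5/3}` for `b ≤ 1` (`A ≥ 0`). [folklore] -/
theorem sq_eps_mul_windowLenB_ge {A b σ : ℝ} (hA : 0 ≤ A) (hb1 : b ≤ 1) (N : ℕ) :
    A * σ ^ 2 * ((N + 1 : ℕ) : ℝ) ^ (-(5 / 3 : ℝ)) ≤ hsDiameter σ N ^ 2 * windowLenB A b N := by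
  unfold windowLenB hsDiameter
  have hn : (0 : ℝ) < ((N + 1 : ℕ) : ℝ) := by positivity
  have h1 := rpow_neg_one_le_rpow_neg hb1 N
  have hsq : (σ * ((N + 1 : ℕ) : ℝ) ^ (-(1 / 3 : ℝ))) ^ 2 = σ ^ 2 * ((N + 1 : ℕ) : ℝ) ^ (-(2 / 3 : ℝ)) := by
    have h2 : (((N + 1 : ℕ) : ℝ) ^ (-(1 / 3 : ℝ))) ^ 2 = ((N + 1 : ℕ) : ℝ) ^ (-(2 / 3 : ℝ)) := by
      rw [← Real.rpow_two, ← Real.rpow_mul hn.le]; norm_num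
    rw [mul_pow, h2]
  have h53 : ((N + 1 : ℕ) : ℝ) ^ (-(5 / 3 : ℝ)) = ((N + 1 : ℕ) : ℝ) ^ (-(2 / 3 : ℝ)) * ((N + 1 : ℕ) : ℝ) ^ (-(1 : ℝ)) := by
    rw [← Real.rpow_add hn]; norm_num
  rw [hsq, h53]
  have h23 : 0 ≤ ((N + 1 : ℕ) : ℝ) ^ (-(2 / 3 : ℝ)) := Real.rpow_nonneg hn.le _
  calc A * σ ^ 2 * (((N + 1 : ℕ) : ℝ) ^ (-(2 / 3 : ℝ)) * ((N + 1 : ℕ) : ℝ) ^ (-(1 : ℝ)))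
      = σ ^ 2 * ((N + 1 : ℕ) : ℝ) ^ (-(2 / 3 : ℝ)) * (A * ((N + 1 : ℕ) : ℝ) ^ (-(1 : ℝ))) := by ring
    _ ≤ σ ^ 2 * ((N + 1 : ℕ) : ℝ) ^ (-(2 / 3 : ℝ)) * (A * ((N + 1 : ℕ) : ℝ) ^ (-b)) :=
        mul_le_mul_of_nonneg_left (mul_le_mul_of_nonneg_left h1 hA) (mul_nonneg (sq_nonneg _) h23)

/-- **The squared-mean scale dominates**: `N² ε_N³ κ_N = N² ε_N² Δ_N ≥ (A σ²/4) n^{1/3}` for `N ≥ 1`, `b ≤ 1`. [folklore] -/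
theorem sq_mul_eps_cube_mul_kappa_ge {A b σ : ℝ} (hA : 0 ≤ A) (hb1 : b ≤ 1) (hσ : 0 < σ) {N : ℕ} (hN : 1 ≤ N) :
    A * σ ^ 2 / 4 * ((N + 1 : ℕ) : ℝ) ^ ((1 / 3 : ℝ)) ≤
      (N : ℝ) ^ 2 * hsDiameter σ N ^ 3 * (windowLenB A b N / hsDiameter σ N) := by
  have hε := hsDiameter_pos hσ N
  have hn : (0 : ℝ) < ((N + 1 : ℕ) : ℝ) := by positivity
  have e : (N : ℝ) ^ 2 * hsDiameter σ N ^ 3 * (windowLenB A b N / hsDiameter σ N) =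
      (N : ℝ) ^ 2 * (hsDiameter σ N ^ 2 * windowLenB A b N) := by
    field_simp
  rw [e]
  have h1 := sq_eps_mul_windowLenB_ge (σ := σ) hA hb1 N
  -- `N² ≥ n²/4`
  have hN2 : ((N + 1 : ℕ) : ℝ) ^ 2 / 4 ≤ (N : ℝ) ^ 2 := by
    have : ((N + 1 : ℕ) : ℝ) ≤ 2 * N := by
      have : (1 : ℝ) ≤ N := by exact_mod_cast hN
      push_cast; linarith
    nlinarith [this, hn]
  have h13 : ((N + 1 : ℕ) : ℝ) ^ ((1 / 3 : ℝ)) = ((N + 1 : ℕ) : ℝ) ^ 2 * ((N + 1 : ℕ) : ℝ) ^ (-(5 / 3 : ℝ)) := by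
    rw [← Real.rpow_natCast, ← Real.rpow_add hn]; norm_num
  rw [h13]
  have h53 : 0 ≤ ((N + 1 : ℕ) : ℝ) ^ (-(5 / 3 : ℝ)) := Real.rpow_nonneg hn.le _
  calc A * σ ^ 2 / 4 * (((N + 1 : ℕ) : ℝ) ^ 2 * ((N + 1 : ℕ) : ℝ) ^ (-(5 / 3 : ℝ)))
      = ((N + 1 : ℕ) : ℝ) ^ 2 / 4 * (A * σ ^ 2 * ((N + 1 : ℕ) : ℝ) ^ (-(5 / 3 : ℝ))) := by ring
    _ ≤ (N : ℝ) ^ 2 * (hsDiameter σ N ^ 2 * windowLenB A b N) :=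
        mul_le_mul hN2 h1 (by positivity) (sq_nonneg _)

/-! ## The shell volume -/

/-- `(1 + x)³ − 1 ≤ 3x(1 + x)²` for `x ≥ 0`. [folklore] -/
theorem cube_sub_one_le {x : ℝ} (hx : 0 ≤ x) : (1 + x) ^ 3 - 1 ≤ 3 * x * (1 + x) ^ 2 := by nlinarith [sq_nonneg x]

/-- **Shell volume**: `(4π/3)((ε(1+2Lκ))³ − ε³) ≤ 8π L κ ε³ (1+2Lκ)²` (`ε, L, κ ≥ 0`). [folklore] -/
theorem shellVol_le {ε L κ : ℝ} (hε : 0 ≤ ε) (hL : 0 ≤ L) (hκ : 0 ≤ κ) :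
    4 / 3 * Real.pi * ((ε * (1 + 2 * L * κ)) ^ 3 - ε ^ 3) ≤ 8 * Real.pi * L * κ * ε ^ 3 * (1 + 2 * L * κ) ^ 2 := by
  have hx : 0 ≤ 2 * L * κ := by positivity
  have h := cube_sub_one_le hx
  have e : (ε * (1 + 2 * L * κ)) ^ 3 - ε ^ 3 = ε ^ 3 * ((1 + 2 * L * κ) ^ 3 - 1) := by ring
  rw [e]
  have hε3 : 0 ≤ ε ^ 3 := pow_nonneg hε 3
  calc 4 / 3 * Real.pi * (ε ^ 3 * ((1 + 2 * L * κ) ^ 3 - 1)) ≤ 4 / 3 * Real.pi * (ε ^ 3 * (3 * (2 * L * κ) * (1 + 2 * L * κ) ^ 2)) :=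
        mul_le_mul_of_nonneg_left (mul_le_mul_of_nonneg_left h hε3) (by positivity)
    _ = 8 * Real.pi * L * κ * ε ^ 3 * (1 + 2 * L * κ) ^ 2 := by ring

/-- The shell volume is nonnegative (`ε, L, κ ≥ 0`). [folklore] -/
theorem shellVol_nonneg {ε L κ : ℝ} (hε : 0 ≤ ε) (hL : 0 ≤ L) (hκ : 0 ≤ κ) :
    0 ≤ 4 / 3 * Real.pi * ((ε * (1 + 2 * L * κ)) ^ 3 - ε ^ 3) := by
  have h1 : ε ≤ ε * (1 + 2 * L * κ) := by nlinarith [mul_nonneg hL hκ]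
  have : ε ^ 3 ≤ (ε * (1 + 2 * L * κ)) ^ 3 := pow_le_pow_left₀ hε h1 3
  have : 0 ≤ (ε * (1 + 2 * L * κ)) ^ 3 - ε ^ 3 := by linarith
  positivity

/-! ## The per-window Chebyshev ratio -/

/-- **The variance-to-squared-deviation ratio of one window.**  With `v` the shell volume, `v ≤ w := 8πLκε³P₂`
(`P₂ = (1+2Lκ₀)²`, `κ ≤ κ₀`), `(3+4Lκ)³ ≤ P₃ = (3+4Lκ₀)³` and `t = ρ n N ε³ κ` (`ρ > 0`, `N ≥ 1`, `κ > 0`):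
`V/t² ≤ X/(N² ε³ κ) + Y n/N² + 4ζ… ` in the explicit form below. [folklore] -/
theorem varianceRatio_le {C L κ κ₀ ε ρ ζ : ℝ} {N : ℕ} (hL : 0 ≤ L) (hκ : 0 < κ) (hκ₀ : κ ≤ κ₀) (hε : 0 < ε)
    (hρ : 0 < ρ) (hζ : 0 ≤ ζ) (hN : 1 ≤ N) :
    (64 * C ^ 2 * (3 + 4 * L * κ) ^ 3 * ((N + 1 : ℕ) : ℝ) ^ 2 * (4 / 3 * Real.pi * ((ε * (1 + 2 * L * κ)) ^ 3 - ε ^ 3)) +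
        2 * (((N + 1 : ℕ) : ℝ) ^ 2 * (16 * C ^ 2 * (4 / 3 * Real.pi * ((ε * (1 + 2 * L * κ)) ^ 3 - ε ^ 3)) +
          96 * ((N + 1 : ℕ) : ℝ) * C ^ 2 * (4 / 3 * Real.pi * ((ε * (1 + 2 * L * κ)) ^ 3 - ε ^ 3)) ^ 2 +
          4 * ζ * ((N + 1 : ℕ) : ℝ) ^ 2 * C ^ 2 * (4 / 3 * Real.pi * ((ε * (1 + 2 * L * κ)) ^ 3 - ε ^ 3)) ^ 2))) /
        (ρ * ((N + 1 : ℕ) : ℝ) * N * ε ^ 3 * κ) ^ 2 ≤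
      (8 * Real.pi * L * (1 + 2 * L * κ₀) ^ 2 * C ^ 2 * (64 * (3 + 4 * L * κ₀) ^ 3 + 32) / ρ ^ 2) / ((N : ℝ) ^ 2 * ε ^ 3 * κ) +
        (192 * C ^ 2 * (8 * Real.pi * L * (1 + 2 * L * κ₀) ^ 2) ^ 2 / ρ ^ 2) * (((N + 1 : ℕ) : ℝ) / (N : ℝ) ^ 2) +
        ζ * (8 * C ^ 2 * (8 * Real.pi * L * (1 + 2 * L * κ₀) ^ 2) ^ 2 / ρ ^ 2) * (((N + 1 : ℕ) : ℝ) ^ 2 / (N : ℝ) ^ 2) := by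
  set n : ℝ := ((N + 1 : ℕ) : ℝ) with hn
  have hn0 : 0 < n := by rw [hn]; positivity
  have hN0 : (0 : ℝ) < N := by exact_mod_cast hN
  set v : ℝ := 4 / 3 * Real.pi * ((ε * (1 + 2 * L * κ)) ^ 3 - ε ^ 3) with hv
  set P₂ : ℝ := (1 + 2 * L * κ₀) ^ 2 with hP₂
  set P₃ : ℝ := (3 + 4 * L * κ₀) ^ 3 with hP₃
  set w : ℝ := 8 * Real.pi * L * P₂ * (κ * ε ^ 3) with hw
  have hv0 : 0 ≤ v := shellVol_nonneg hε.le hL hκ.le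
  have hκ₀0 : 0 ≤ κ₀ := hκ.le.trans hκ₀
  have hvw : v ≤ w := by
    have h1 := shellVol_le hε.le hL hκ.le
    have h2 : (1 + 2 * L * κ) ^ 2 ≤ P₂ := by
      rw [hP₂]; exact pow_le_pow_left₀ (by positivity) (by nlinarith) 2
    calc v ≤ 8 * Real.pi * L * κ * ε ^ 3 * (1 + 2 * L * κ) ^ 2 := h1
      _ ≤ 8 * Real.pi * L * κ * ε ^ 3 * P₂ := mul_le_mul_of_nonneg_left h2 (by positivity)
      _ = w := by rw [hw]; ring
  have hw0 : 0 ≤ w := hv0.trans hvw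
  have hP3 : (3 + 4 * L * κ) ^ 3 ≤ P₃ := by
    rw [hP₃]; exact pow_le_pow_left₀ (by positivity) (by nlinarith) 3
  have hP30 : 0 ≤ (3 + 4 * L * κ) ^ 3 := by positivity
  -- numerator bound
  have hnum : 64 * C ^ 2 * (3 + 4 * L * κ) ^ 3 * n ^ 2 * v + 2 * (n ^ 2 * (16 * C ^ 2 * v + 96 * n * C ^ 2 * v ^ 2 + 4 * ζ * n ^ 2 * C ^ 2 * v ^ 2)) ≤
      C ^ 2 * (64 * P₃ + 32) * n ^ 2 * w + 192 * n ^ 3 * C ^ 2 * w ^ 2 + 8 * ζ * n ^ 4 * C ^ 2 * w ^ 2 := by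
    have hv2 : v ^ 2 ≤ w ^ 2 := pow_le_pow_left₀ hv0 hvw 2
    have hC2 : 0 ≤ C ^ 2 := sq_nonneg C
    have e : C ^ 2 * (64 * P₃ + 32) * n ^ 2 * w + 192 * n ^ 3 * C ^ 2 * w ^ 2 + 8 * ζ * n ^ 4 * C ^ 2 * w ^ 2 =
        64 * C ^ 2 * P₃ * n ^ 2 * w + 2 * (n ^ 2 * (16 * C ^ 2 * w + 96 * n * C ^ 2 * w ^ 2 + 4 * ζ * n ^ 2 * C ^ 2 * w ^ 2)) := by ring
    rw [e]
    gcongr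
  -- denominator identity and positivity
  have hden : (ρ * n * N * ε ^ 3 * κ) ^ 2 = ρ ^ 2 * n ^ 2 * ((N : ℝ) ^ 2 * ε ^ 3 * κ) * (ε ^ 3 * κ) := by ring
  have hD0 : 0 < (ρ * n * N * ε ^ 3 * κ) ^ 2 := by positivity
  have hE : 0 < (N : ℝ) ^ 2 * ε ^ 3 * κ := by positivity
  rw [div_le_iff₀ hD0]
  refine hnum.trans ?_
  -- expand the right-hand side times the denominator
  have hw2 : w ^ 2 = (8 * Real.pi * L * P₂) ^ 2 * (κ * ε ^ 3) ^ 2 := by rw [hw]; ring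
  rw [hden, hw2, hw]
  have hrhs : (8 * Real.pi * L * P₂ * C ^ 2 * (64 * P₃ + 32) / ρ ^ 2 / ((N : ℝ) ^ 2 * ε ^ 3 * κ) +
        192 * C ^ 2 * (8 * Real.pi * L * P₂) ^ 2 / ρ ^ 2 * (n / (N : ℝ) ^ 2) +
        ζ * (8 * C ^ 2 * (8 * Real.pi * L * P₂) ^ 2 / ρ ^ 2) * (n ^ 2 / (N : ℝ) ^ 2)) *
        (ρ ^ 2 * n ^ 2 * ((N : ℝ) ^ 2 * ε ^ 3 * κ) * (ε ^ 3 * κ)) =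
      C ^ 2 * (64 * P₃ + 32) * n ^ 2 * (8 * Real.pi * L * P₂ * (κ * ε ^ 3)) +
        192 * n ^ 3 * C ^ 2 * ((8 * Real.pi * L * P₂) ^ 2 * (κ * ε ^ 3) ^ 2) +
        8 * ζ * n ^ 4 * C ^ 2 * ((8 * Real.pi * L * P₂) ^ 2 * (κ * ε ^ 3) ^ 2) := by
    field_simp
  rw [hrhs]

/-! ## Eventual smallness -/

/-- `n^{-1/3} ≤ c` eventually (`c > 0`). [folklore] -/
theorem eventually_rpow_le {c : ℝ} (hc : 0 < c) :
    ∀ᶠ N : ℕ in atTop, ((N + 1 : ℕ) : ℝ) ^ (-(1 / 3 : ℝ)) ≤ c := by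
  have h1 : Tendsto (fun N : ℕ => (((N + 1 : ℕ) : ℝ))) atTop atTop :=
    tendsto_natCast_atTop_atTop.comp (tendsto_add_atTop_nat 1)
  have h2 := (tendsto_rpow_neg_atTop (by norm_num : (0 : ℝ) < 1 / 3)).comp h1
  exact (h2.eventually (Iic_mem_nhds hc)).mono fun _ hN => hN

/-- `n^{1/3} ≥ c` eventually. [folklore] -/
theorem eventually_le_rpow (c : ℝ) :
    ∀ᶠ N : ℕ in atTop, c ≤ ((N + 1 : ℕ) : ℝ) ^ ((1 / 3 : ℝ)) := by
  have h1 : Tendsto (fun N : ℕ => (((N + 1 : ℕ) : ℝ))) atTop atTop :=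
    tendsto_natCast_atTop_atTop.comp (tendsto_add_atTop_nat 1)
  have h2 := (tendsto_rpow_atTop (by norm_num : (0 : ℝ) < 1 / 3)).comp h1
  exact (h2.eventually (eventually_ge_atTop c)).mono fun _ hN => hN

/-- `n/N² ≤ c` eventually (`c > 0`): `n/N² ≤ 2/N`. [folklore] -/
theorem eventually_succ_div_sq_le {c : ℝ} (hc : 0 < c) :
    ∀ᶠ N : ℕ in atTop, ((N + 1 : ℕ) : ℝ) / (N : ℝ) ^ 2 ≤ c := by
  have h1 : Tendsto (fun N : ℕ => (2 : ℝ) / N) atTop (𝓝 0) :=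
    tendsto_const_nhds.div_atTop tendsto_natCast_atTop_atTop
  filter_upwards [h1.eventually (Iic_mem_nhds hc), eventually_ge_atTop 1] with N hN hN1
  have hN0 : (0 : ℝ) < N := by exact_mod_cast hN1
  have : ((N + 1 : ℕ) : ℝ) / (N : ℝ) ^ 2 ≤ 2 / N := by
    rw [div_le_div_iff₀ (by positivity) hN0]
    have : ((N + 1 : ℕ) : ℝ) ≤ 2 * N := by
      have : (1 : ℝ) ≤ N := by exact_mod_cast hN1
      push_cast; linarith
    nlinarith
  exact this.trans hN

/-- `n²/N² ≤ 4` for `N ≥ 1`. [folklore] -/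
theorem succ_sq_div_sq_le_four {N : ℕ} (hN : 1 ≤ N) : ((N + 1 : ℕ) : ℝ) ^ 2 / (N : ℝ) ^ 2 ≤ 4 := by
  have hN0 : (0 : ℝ) < N := by exact_mod_cast hN
  rw [div_le_iff₀ (by positivity)]
  have : ((N + 1 : ℕ) : ℝ) ≤ 2 * N := by
    have : (1 : ℝ) ≤ N := by exact_mod_cast hN
    push_cast; linarith
  nlinarith

/-- `Δ_N ≤ c` eventually (`c > 0`, `b ≥ 1/3`, `A ≥ 0`). [folklore] -/
theorem eventually_windowLenB_le {A b c : ℝ} (hA : 0 ≤ A) (hb : 1 / 3 ≤ b) (hc : 0 < c) :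
    ∀ᶠ N : ℕ in atTop, windowLenB A b N ≤ c := by
  filter_upwards [eventually_rpow_le (show 0 < c / (A + 1) by positivity)] with N hN
  calc windowLenB A b N ≤ A * ((N + 1 : ℕ) : ℝ) ^ (-(1 / 3 : ℝ)) := windowLenB_le hA hb N
    _ ≤ A * (c / (A + 1)) := mul_le_mul_of_nonneg_left hN hA
    _ ≤ c := by
        rw [mul_div_assoc']
        rw [div_le_iff₀ (by positivity)]
        nlinarith

/-- `ε_N ≤ c` eventually (`c > 0`). [folklore] -/
theorem eventually_hsDiameter_le (σ : ℝ) {c : ℝ} (hc : 0 < c) : ∀ᶠ N : ℕ in atTop, hsDiameter σ N ≤ c :=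
  ((tendsto_hsDiameter σ).eventually (Iic_mem_nhds hc)).mono fun _ hN => hN

/-- Registered stub `stub_kappaLeRung0` of crux stmt-AtomisticToContinuum-13080 (line `Sketch`, c2 lane): the closed form of `kappa_le`. -/
theorem stub_kappaLeRung0 : ∀ (A b σ : ℝ), 0 ≤ A → 1 / 3 ≤ b → 0 < σ → ∀ N : ℕ, RateFloorLine.windowLenB A b N / hsDiameter σ N ≤ A / σ :=
  fun _A _b _σ hA hb hσ N => kappa_le hA hb hσ N

end RateFloorStaticFloor

end Summit.AtomisticToContinuum.HydrodynamicLimit.Theorems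

end
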